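import Summits.BirchSwinnertonDyer.BirchSwinnertonDyer.Theorems.KatoDescentPotSupersingularCartanMuRoadRealDoors
import Literature.NumberTheory.IwasawaTheory.ClassicalMuVanishesUnitNormIndex
import Literature.NumberTheory.EllipticCurves.DivisionFieldUnipotentStabilizer
import HarnessLib

/-!
# K9 `WildCoatesSujathaResidue` (stmt-19942) / U₀-ns node 19189 / item 19197 `WildUpperDefectRankZero` — statement (A) at `(W, 3)` and
# U₀ `MissingUpperBoundAt W 3` with the classical `μ`-hypothesis fed by the UNIT NORM-INDEX DOOR (Chevalley ∘ Fukuda) or by FUKUDA (0,1),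
# on the two carrier fields of the cell's `p = 3` roads: the maximal real subfield `K⁺ = ℚ(W[3])⁺` (Cartan rows) and the
# unipotent-stabiliser field `L_P = ℚ(W[3])^{U_P} = ℚ(P, ζ₃)` (any row, in particular `GL₂(𝔽₃)`-image rows)
# (cell `bsd-potss`, seat `bsd-potss-k9-c4` g19; route-free; `--supports` 19197 / 19942; closes nothing)

HONEST FRAMING. THEOREMS ONLY (no definition, no named fact, no `sorry`), all one-step compositions of LANDED theorems; per-row DOORS
(their numeric hypotheses are displayed and certified per row by PARI/GP, never kernel-computed); CONDITIONAL on the named facts;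
Coates–Sujatha's (A), Conjecture A and BSD are proved for NO curve here; items 19942 / 19189 / 19197 stay OPEN class-wide (open input:
the zeta crux 24327 `WildKatoZetaIndivisible`).

THE TWO `μ`-CRITERIA used as inputs (tree theorems of `Literature/NumberTheory/IwasawaTheory/`):
* UNIT NORM-INDEX (conjA-anchor g12, `ClassicalMuVanishesUnitNormIndex.lean`, `forall_classicalMuVanishes_of_relIndex_mul_eq`): for a number
  field `F`, `p` odd, `p ∤ h(F)`, `s` primes of `F` above `p`, every cyclotomic `ℤ_p`-extension of `F` totally ramified at them from
  layer `0` (`TotallyRamifiedFrom κ 0`) and with first-layer unit norm index `[E_F : E_F ∩ N_{F₁/F} F₁ˣ]·p = p^s` — then, granted Fukuda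
  1994 Thm. 1 (1) (`fukuda1994_thm1_classNumberPExp_const_of_succ_eq`, named fact), `μ = 0` (indeed `A_n = 0` for all `n`) for every
  cyclotomic `ℤ_p`-extension of `F` (Chevalley's ambiguous class number formula, Lang Ch. 13 §4 Lemma 4.1, a tree theorem).
* FUKUDA (0,1) (`ClassicalMuInvariant.classicalMuVanishes_of_classNumberPExp_succ_eq`): `TotallyRamifiedFrom κ 0` and `e₁(κ) = e₀(κ)` ⟹
  `μ = 0` (granted the same named fact).
THE TWO CARRIER FIELDS:
* `K⁺ :=` the fixed field in `ℚ(W[3])` of a complex conjugation `c` (`= ℚ(P)`, `P` a real `3`-torsion point; degree `4` on `3Ns` rows,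
  `8` on `3Nn` rows): input of this seat's g18 doors `CartanMuRoadRealDoors.conjA_three_of_…_of_realMu` (conjA-anchor g11's Cartan roads
  N3/N4 with the involution binders discharged by `c`) — §2 below re-keys their `hμ` to the two criteria;
* `L_P := W.unipotentStabilizerField 3 P` (conjA-anchor g9, `DivisionFieldUnipotentStabilizer.lean`: `= ℚ(W[3])^{U_P}`, by the Weil
  pairing `ℚ(P, ζ₃)` for `P ≠ 0`; `[ℚ(W[3]) : L_P] ∈ {1, 3}` STRUCTURALLY, so Lim 2017 Thm. 3.5 applies): §1 adds the unit norm-index door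
  to conjA-anchor g9's Iwasawa-1956 / Fukuda doors on that field (named facts: Lim 2017 Thm. 3.5 `hLim`, Fukuda `hF1`), for any `W`, odd `p`,
  `P`; §3 gives U₀ at `p = 3` (Kato A161-fine + GZK + modularity, via k9-c4 g5's `missingUpperBoundAt_wild_of_conjA`).
USE (this seat's records, kit j308542): `3Ns` rows 100386bx1 / 155142bf1 / 483678bi1 (`K⁺ = ℚ[x]/(x⁴−x³+2x²−9x+3)`: `h = 1`
certified, two primes above `3` with `e·f = 2, 2`, unit symbol rank `1` ⟹ PASS), `3Ns` row 272214x1 (`3 ∣ h(K⁺) = 3` but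
`e₀ = e₁ = 1`: Fukuda), and the `GL₂(𝔽₃)`-image residue rows of 19942 on `L_P` (degree 16).

References: [Lang1990] Ch. 13 §4 Lemma 4.1; [Fukuda1994] Thm. 1 (1); [Lim2017FineSelmer] §3 Thm. 3.5, Lemma 3.2; [CoatesSujatha2005]
Thm. 3.4; [Kato2004Asterisque] Thm. 14.5 (3); [Serre1972] §2.2, §IV; [Washington1997] §13.1.
-/

set_option linter.dupNamespace false
set_option autoImplicit false

noncomputable section

open scoped NumberField
open Field IntermediateField WeierstrassCurve IsDedekindDomain Literature.NumberTheory.EllipticCurves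
  Literature.NumberTheory.GaloisRepresentations Literature.NumberTheory.SerreUniformity
  Literature.NumberTheory.IwasawaTheory Literature.NumberTheory.EllipticCurves.Rank1Residual.Typed
  Literature.NumberTheory.GaloisRepresentations.Herbrand Literature.NumberTheory.GaloisRepresentations.MinkowskiUnit
  Literature.NumberTheory.GaloisRepresentations.CyclicNormIndex
  Summit.BirchSwinnertonDyer.Rank1Residual.Additive

namespace Summit.BirchSwinnertonDyer.BirchSwinnertonDyer.Theorems.UnitIndexMuDoors

/-! ## §1 The unit norm-index door on a subfield `L ≤ ℚ(W[p])` of `p`-power index (Lim 2017 Thm. 3.5), and on `L_P` -/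

/-- **Statement (A) at `(W, p)` from the UNIT NORM-INDEX criterion on a subfield `L ⊆ ℚ(W[p])` with `[ℚ(W[p]) : L]` a power of `p`**
(granted the named facts Fukuda 1994 Thm. 1 (1) `hF1` and Lim 2017 Thm. 3.5 `hLim`): `p` odd, `p ∤ h(L)`, `s` primes of `L` above `p`,
every cyclotomic `ℤ_p`-extension of `L` with Fukuda's index `n₀ = 0` and first-layer unit norm index `p^{s−1}` ⟹ the dual fine Selmer
group of `W` over `ℚ_cyc` is finitely generated over `ℤ_p`.  One line: conjA-anchor g12's `forall_classicalMuVanishes_of_relIndex_mul_eq`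
into `hLim`. CONDITIONAL; (A) asserted for no curve. [cite: Lim2017FineSelmer, §3 Thm. 3.5 and Lemma 3.2 (arXiv:1306.2047 pp. 6–7)]
[cite: Lang1990, Ch. 13 §4, Lemma 4.1 (PDF p. 203)] [cite: Fukuda1994, Thm. 1 (1), p. 264] -/
theorem fineSelmerDual_moduleFinite_of_relIndex_mul_eq_of_le_divisionField
    (hF1 : fukuda1994_thm1_classNumberPExp_const_of_succ_eq)
    (hLim : Lim2017.thm35_fineSelmerDual_moduleFinite_of_classicalMuVanishes_of_le_divisionField)
    (W : WeierstrassCurve ℚ) [W.IsElliptic] (p : ℕ) [Fact p.Prime] (hp : p ≠ 2)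
    (L : IntermediateField ℚ (AlgebraicClosure ℚ)) [NumberField L]
    (hL : haveI : NeZero p := ⟨(Fact.out : p.Prime).ne_zero⟩; L ≤ W.divisionField p)
    (hk : haveI : NeZero p := ⟨(Fact.out : p.Prime).ne_zero⟩
      ∃ k : ℕ, Module.finrank ℚ (W.divisionField p) = p ^ k * Module.finrank ℚ L)
    (hh : ¬ p ∣ NumberField.classNumber L) {s : ℕ}
    (hs : {v : HeightOneSpectrum (𝓞 L) | ((p : ℕ) : 𝓞 L) ∈ v.asIdeal}.ncard = s)
    (hram : ∀ κ : ZpExtension L p, κ.IsCyclotomic → TotallyRamifiedFrom κ 0)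
    (hidx : ∀ κ : ZpExtension L p, κ.IsCyclotomic →
      haveI : FiniteDimensional L (κ.layer 1) := κ.finiteDimensional_layer_holds 1
      (unitsE (κ.layer 1) ⊓ (⊤ : Subgroup (κ.layer 1)ˣ).map
          (Herbrand.norm (κ.layer 1 ≃ₐ[L] κ.layer 1))).relIndex
        (unitsE (κ.layer 1) ⊓ (unitsIncl L (κ.layer 1)).range) * p = p ^ s)
    (κ : ZpExtension ℚ p) (hκ : κ.IsCyclotomic) :
    ∃ (γ : absoluteGaloisGroup ℚ) (D : W.FineSelmerDualData κ γ),
      Module.Finite ℤ_[p] (RestrictScalars ℤ_[p] (IwasawaAlgebra p) D.X) := by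
  haveI : NeZero p := ⟨(Fact.out : p.Prime).ne_zero⟩
  exact hLim W p hp L hL hk (forall_classicalMuVanishes_of_relIndex_mul_eq hF1 hp hh hs hram hidx) κ hκ

/-- `L_P = ℚ(W[p])^{U_P}` is a number field (a subfield of the finite Galois extension `ℚ(W[p])/ℚ`). [folklore] -/
theorem numberField_unipotentStabilizerField (W : WeierstrassCurve ℚ) [W.IsElliptic] (p : ℕ) [Fact p.Prime]
    (P : W.geomTorsion p) :
    haveI : NeZero p := ⟨(Fact.out : p.Prime).ne_zero⟩
    NumberField ↥(W.unipotentStabilizerField p P) := by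
  haveI : NeZero p := ⟨(Fact.out : p.Prime).ne_zero⟩
  have hL := W.unipotentStabilizerField_le_divisionField p P
  haveI : FiniteDimensional ℚ ↥(W.unipotentStabilizerField p P) :=
    FiniteDimensional.of_injective (IntermediateField.inclusion hL).toLinearMap (IntermediateField.inclusion_injective hL)
  exact NumberField.mk

/-- **Statement (A) at `(W, p)` from the UNIT NORM-INDEX criterion on `L_P = ℚ(W[p])^{U_P}`** (`= ℚ(P, ζ_p)` for `P ≠ 0`; granted
`hF1`, `hLim`): `p` odd, `p ∤ h(L_P)`, `s` primes of `L_P` above `p`, Fukuda index `0` and first-layer unit norm index `p^{s−1}` for every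
cyclotomic `ℤ_p`-extension of `L_P`.  Lim's index hypothesis is discharged STRUCTURALLY (conjA-anchor g9's
`exists_finrank_divisionField_eq_pow_mul_finrank_unipotentStabilizerField`).  This is the third door on `L_P` next to conjA-anchor g9's
Iwasawa-1956 and Fukuda doors; it is the one that fits `GL₂(𝔽₃)`-image rows at `p = 3` (`L_P` of degree `16` has `2` or `4` primes above
`3` on the census, never one). CONDITIONAL; (A) asserted for no curve.
[cite: Lim2017FineSelmer, §3 Thm. 3.5 and Lemma 3.2 (arXiv:1306.2047 pp. 6–7)] [cite: Lang1990, Ch. 13 §4, Lemma 4.1 (PDF p. 203)]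
[cite: Fukuda1994, Thm. 1 (1), p. 264] [cite: Serre1972, §IV] -/
theorem fineSelmerDual_moduleFinite_of_relIndex_mul_eq_unipotentStabilizerField
    (hF1 : fukuda1994_thm1_classNumberPExp_const_of_succ_eq)
    (hLim : Lim2017.thm35_fineSelmerDual_moduleFinite_of_classicalMuVanishes_of_le_divisionField)
    (W : WeierstrassCurve ℚ) [W.IsElliptic] (p : ℕ) [Fact p.Prime] (hp : p ≠ 2) (P : W.geomTorsion p)
    (hh : haveI : NeZero p := ⟨(Fact.out : p.Prime).ne_zero⟩
      haveI := numberField_unipotentStabilizerField W p P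
      ¬ p ∣ NumberField.classNumber ↥(W.unipotentStabilizerField p P)) {s : ℕ}
    (hs : haveI : NeZero p := ⟨(Fact.out : p.Prime).ne_zero⟩
      {v : HeightOneSpectrum (𝓞 ↥(W.unipotentStabilizerField p P)) |
        ((p : ℕ) : 𝓞 ↥(W.unipotentStabilizerField p P)) ∈ v.asIdeal}.ncard = s)
    (hram : haveI : NeZero p := ⟨(Fact.out : p.Prime).ne_zero⟩
      ∀ κ : ZpExtension ↥(W.unipotentStabilizerField p P) p, κ.IsCyclotomic → TotallyRamifiedFrom κ 0)
    (hidx : haveI : NeZero p := ⟨(Fact.out : p.Prime).ne_zero⟩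
      haveI := numberField_unipotentStabilizerField W p P
      ∀ κ : ZpExtension ↥(W.unipotentStabilizerField p P) p, κ.IsCyclotomic →
      haveI : FiniteDimensional ↥(W.unipotentStabilizerField p P) (κ.layer 1) := κ.finiteDimensional_layer_holds 1
      (unitsE (κ.layer 1) ⊓ (⊤ : Subgroup (κ.layer 1)ˣ).map
          (Herbrand.norm (κ.layer 1 ≃ₐ[↥(W.unipotentStabilizerField p P)] κ.layer 1))).relIndex
        (unitsE (κ.layer 1) ⊓ (unitsIncl ↥(W.unipotentStabilizerField p P) (κ.layer 1)).range) * p = p ^ s)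
    (κ : ZpExtension ℚ p) (hκ : κ.IsCyclotomic) :
    ∃ (γ : absoluteGaloisGroup ℚ) (D : W.FineSelmerDualData κ γ),
      Module.Finite ℤ_[p] (RestrictScalars ℤ_[p] (IwasawaAlgebra p) D.X) := by
  haveI : NeZero p := ⟨(Fact.out : p.Prime).ne_zero⟩
  haveI := numberField_unipotentStabilizerField W p P
  exact fineSelmerDual_moduleFinite_of_relIndex_mul_eq_of_le_divisionField hF1 hLim W p hp _
    (W.unipotentStabilizerField_le_divisionField p P)
    (W.exists_finrank_divisionField_eq_pow_mul_finrank_unipotentStabilizerField p P) hh hs hram hidx κ hκ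

/-! ## §2 The Cartan road on `K⁺ = ℚ(W[3])⁺` with `hμ` fed by the unit norm-index door / by Fukuda (0,1) -/

section Cartan

variable (W : WeierstrassCurve ℚ) [W.IsElliptic]

/-! The carrier is presented as an intermediate field `Kp` of `ℚ(W[3])/ℚ` together with the identification `hKp : Kp = ℚ(W[3])^{c}`
(the fixed field of the restriction of a complex conjugation `c`) — so that the numeric hypotheses are stated over the short name `Kp`
and instantiated by records with `hKp`; even so the instance `Module ↥Kp ↥(κ.layer 1)` (an intermediate field of an intermediate field
of `ℚ(W[3])`) needs a raised `synthInstance.maxHeartbeats` to be found — statement elaboration only, the proofs are one-liners. -/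

set_option synthInstance.maxHeartbeats 400000 in
set_option maxHeartbeats 4000000 in
/-- **(A) at `(W,3)` on a `3Ns` row from the UNIT NORM-INDEX criterion on `K⁺ = ℚ(W[3])⁺`** (modulo the named facts Coates–Sujatha
Thm. 3.4 `hCS`, Ferrero–Washington `hFW`, Fukuda Thm. 1 (1) `hF1`): image in `C_s⁺(3)`, `c` a complex conjugation, `Kp` its fixed field in
`ℚ(W[3])` (`hKp`), `3 ∤ h(Kp)` (`hh`), `s` primes of `Kp` above `3` (`hs`), and for every cyclotomic `ℤ_3`-extension of `Kp`: Fukuda index `0`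
(`hram`) and first-layer unit norm index `3^{s−1}` (`hidx`). [cite: Lang1990, Ch. 13 §4, Lemma 4.1 (PDF p. 203)] [cite: Fukuda1994, Thm. 1 (1), p. 264]
[cite: CoatesSujatha2005, Thm. 3.4 (§3)] [cite: Serre1972, §5.2 (iv)] -/
theorem conjA_three_of_hasSplitCartanNormalizerModPImage_of_realUnitIndex
    (hCS : CoatesSujatha2005.thm34_fineSelmerDual_moduleFinite_of_classicalMuVanishes_divisionField)
    (hFW : ferreroWashington1979_classicalMuVanishes) (hF1 : fukuda1994_thm1_classNumberPExp_const_of_succ_eq)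
    (himg : HasSplitCartanNormalizerModPImage W 3) {c : absoluteGaloisGroup ℚ} (hc : IsComplexConjugation (Rat.castHom ℝ) c)
    (Kp : IntermediateField ℚ ↥(W.divisionField 3)) (hKp : Kp = fixedField (Subgroup.zpowers (absRestrictNormalHom (W.divisionField 3) c)))
    (hh : haveI : NumberField ↥(W.divisionField 3) := NumberField.mk
      ¬ 3 ∣ NumberField.classNumber ↥Kp) {s : ℕ}
    (hs : {v : HeightOneSpectrum (𝓞 ↥Kp) | ((3 : ℕ) : 𝓞 ↥Kp) ∈ v.asIdeal}.ncard = s)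
    (hram : ∀ κE : ZpExtension ↥Kp 3, κE.IsCyclotomic → TotallyRamifiedFrom κE 0)
    (hidx : haveI : NumberField ↥(W.divisionField 3) := NumberField.mk
      ∀ κE : ZpExtension ↥Kp 3, κE.IsCyclotomic →
      haveI : FiniteDimensional ↥Kp (κE.layer 1) := κE.finiteDimensional_layer_holds 1
      (unitsE (κE.layer 1) ⊓ (⊤ : Subgroup (κE.layer 1)ˣ).map (Herbrand.norm (κE.layer 1 ≃ₐ[↥Kp] κE.layer 1))).relIndex
        (unitsE (κE.layer 1) ⊓ (unitsIncl ↥Kp (κE.layer 1)).range) * 3 = 3 ^ s)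
    (κ : ZpExtension ℚ 3) (hκ : κ.IsCyclotomic) :
    ∃ (γ : absoluteGaloisGroup ℚ) (D : W.FineSelmerDualData κ γ),
      Module.Finite ℤ_[3] (RestrictScalars ℤ_[3] (IwasawaAlgebra 3) D.X) := by
  haveI : NumberField ↥(W.divisionField 3) := NumberField.mk
  haveI : Fact (Nat.Prime 3) := ⟨Nat.prime_three⟩
  subst hKp
  exact CartanMuRoadRealDoors.conjA_three_of_hasSplitCartanNormalizerModPImage_of_realMu W hCS hFW himg hc
    (forall_classicalMuVanishes_of_relIndex_mul_eq hF1 (by decide) hh hs hram hidx) κ hκ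

set_option synthInstance.maxHeartbeats 400000 in
set_option maxHeartbeats 4000000 in
/-- **(A) at `(W,3)` on a `3Ns` row from FUKUDA (0,1) on `K⁺ = ℚ(W[3])⁺`** (modulo `hCS`, `hFW`, Fukuda Thm. 1 (1) `hF1`): image in
`C_s⁺(3)`, `c` a complex conjugation, `Kp = ℚ(W[3])^c` (`hKp`), and for every cyclotomic `ℤ_3`-extension of `Kp`: Fukuda index `0` (`hram`)
and `ord₃ h(Kp₁) = ord₃ h(Kp)` (`hord`; `Kp₁ = Kp·ℚ(ζ₉)⁺`, degree `12` on `3Ns` rows). For rows with `3 ∣ h(K⁺)` (e.g. 272214x1).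
[cite: Fukuda1994, Thm. 1 (1), p. 264] [cite: CoatesSujatha2005, Thm. 3.4 (§3)] [cite: Serre1972, §5.2 (iv)] -/
theorem conjA_three_of_hasSplitCartanNormalizerModPImage_of_realSuccEq
    (hCS : CoatesSujatha2005.thm34_fineSelmerDual_moduleFinite_of_classicalMuVanishes_divisionField)
    (hFW : ferreroWashington1979_classicalMuVanishes) (hF1 : fukuda1994_thm1_classNumberPExp_const_of_succ_eq)
    (himg : HasSplitCartanNormalizerModPImage W 3) {c : absoluteGaloisGroup ℚ} (hc : IsComplexConjugation (Rat.castHom ℝ) c)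
    (Kp : IntermediateField ℚ ↥(W.divisionField 3)) (hKp : Kp = fixedField (Subgroup.zpowers (absRestrictNormalHom (W.divisionField 3) c)))
    (hram : ∀ κE : ZpExtension ↥Kp 3, κE.IsCyclotomic → TotallyRamifiedFrom κE 0)
    (hord : ∀ κE : ZpExtension ↥Kp 3, κE.IsCyclotomic → classNumberPExp κE (0 + 1) = classNumberPExp κE 0)
    (κ : ZpExtension ℚ 3) (hκ : κ.IsCyclotomic) :
    ∃ (γ : absoluteGaloisGroup ℚ) (D : W.FineSelmerDualData κ γ),
      Module.Finite ℤ_[3] (RestrictScalars ℤ_[3] (IwasawaAlgebra 3) D.X) := by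
  haveI : NumberField ↥(W.divisionField 3) := NumberField.mk
  subst hKp
  exact CartanMuRoadRealDoors.conjA_three_of_hasSplitCartanNormalizerModPImage_of_realMu W hCS hFW himg hc
    (fun κE hκE => classicalMuVanishes_of_classNumberPExp_succ_eq hF1 κE (hram κE hκE) (Nat.zero_le 0) (hord κE hκE)) κ hκ

set_option synthInstance.maxHeartbeats 400000 in
set_option maxHeartbeats 4000000 in
/-- **(A) at `(W,3)` on a `3Nn` row from the UNIT NORM-INDEX criterion on `K⁺`** (modulo `hCS`, Iwasawa's growth theorem `hI`, `hFW`,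
`hF1`): image `= C_ns⁺(3)`, `c` a complex conjugation, `Kp = ℚ(W[3])^c` (`hKp`), `3 ∤ h(Kp)`, `s` primes above `3`, Fukuda index `0`,
unit norm index `3^{s−1}` (the `3Nn` row 406593q1 has `s = 5`). [cite: Lang1990, Ch. 13 §4, Lemma 4.1 (PDF p. 203)]
[cite: Fukuda1994, Thm. 1 (1), p. 264] [cite: CoatesSujatha2005, Thm. 3.4 (§3)] [cite: Washington1997, §13.1] -/
theorem conjA_three_of_hasModPImageEqNonsplitCartanNormalizer_of_realUnitIndex
    (hCS : CoatesSujatha2005.thm34_fineSelmerDual_moduleFinite_of_classicalMuVanishes_divisionField)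
    (hI : iwasawa1959_classNumberPExp_growth) (hFW : ferreroWashington1979_classicalMuVanishes)
    (hF1 : fukuda1994_thm1_classNumberPExp_const_of_succ_eq)
    (himg : HasModPImageEqNonsplitCartanNormalizer W 3) {c : absoluteGaloisGroup ℚ} (hc : IsComplexConjugation (Rat.castHom ℝ) c)
    (Kp : IntermediateField ℚ ↥(W.divisionField 3)) (hKp : Kp = fixedField (Subgroup.zpowers (absRestrictNormalHom (W.divisionField 3) c)))
    (hh : haveI : NumberField ↥(W.divisionField 3) := NumberField.mk
      ¬ 3 ∣ NumberField.classNumber ↥Kp) {s : ℕ}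
    (hs : {v : HeightOneSpectrum (𝓞 ↥Kp) | ((3 : ℕ) : 𝓞 ↥Kp) ∈ v.asIdeal}.ncard = s)
    (hram : ∀ κE : ZpExtension ↥Kp 3, κE.IsCyclotomic → TotallyRamifiedFrom κE 0)
    (hidx : haveI : NumberField ↥(W.divisionField 3) := NumberField.mk
      ∀ κE : ZpExtension ↥Kp 3, κE.IsCyclotomic →
      haveI : FiniteDimensional ↥Kp (κE.layer 1) := κE.finiteDimensional_layer_holds 1
      (unitsE (κE.layer 1) ⊓ (⊤ : Subgroup (κE.layer 1)ˣ).map (Herbrand.norm (κE.layer 1 ≃ₐ[↥Kp] κE.layer 1))).relIndex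
        (unitsE (κE.layer 1) ⊓ (unitsIncl ↥Kp (κE.layer 1)).range) * 3 = 3 ^ s)
    (κ : ZpExtension ℚ 3) (hκ : κ.IsCyclotomic) :
    ∃ (γ : absoluteGaloisGroup ℚ) (D : W.FineSelmerDualData κ γ),
      Module.Finite ℤ_[3] (RestrictScalars ℤ_[3] (IwasawaAlgebra 3) D.X) := by
  haveI : NumberField ↥(W.divisionField 3) := NumberField.mk
  haveI : Fact (Nat.Prime 3) := ⟨Nat.prime_three⟩
  subst hKp
  exact CartanMuRoadRealDoors.conjA_three_of_hasModPImageEqNonsplitCartanNormalizer_of_realMu' W hCS hI hFW himg hc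
    (forall_classicalMuVanishes_of_relIndex_mul_eq hF1 (by decide) hh hs hram hidx) κ hκ

variable [W.IsGloballyMinimal]

set_option synthInstance.maxHeartbeats 400000 in
set_option maxHeartbeats 4000000 in
/-- **U₀ at a `3Ns` residue row from the UNIT NORM-INDEX criterion on `K⁺`**: `MissingUpperBoundAt W 3` for a rank-`0` O6 row with
`W[3]` irreducible and image in `C_s⁺(3)`, from the named facts {A161-fine `hKatoA`, GZK `hGZK`, modularity `hmod`, `hCS`, `hFW`, Fukuda
`hF1`} and the displayed numerics `hh`, `hs`, `hram`, `hidx` about `Kp = ℚ(W[3])^c`. CONDITIONAL; nothing booked; BSD for no curve.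
[cite: Kato2004Asterisque, Thm. 14.5 (3) (p. 236)] [cite: Lang1990, Ch. 13 §4, Lemma 4.1 (PDF p. 203)] [cite: CoatesSujatha2005, Thm. 3.4 (§3)] -/
theorem missingUpperBoundAt_three_of_hasSplitCartanNormalizerModPImage_of_realUnitIndex
    (hKatoA : Kato2004.rankZero_padicValNat_sha_add_padicValNat_tamagawa_le_of_additive_potGood_of_irreducible_of_fineSelmerDual_fg)
    (hGZK : rank_eq_analyticRank_of_analyticRank_le_one) (hmod : hasEntireLFunction_rat)
    (hCS : CoatesSujatha2005.thm34_fineSelmerDual_moduleFinite_of_classicalMuVanishes_divisionField)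
    (hFW : ferreroWashington1979_classicalMuVanishes) (hF1 : fukuda1994_thm1_classNumberPExp_const_of_succ_eq) [Fact (3 : ℕ).Prime]
    (hr : W.analyticRank = 0) (hO : ClassO6 W 3) (hirr : W.HasIrreducibleModPGaloisRep 3)
    (himg : HasSplitCartanNormalizerModPImage W 3) {c : absoluteGaloisGroup ℚ} (hc : IsComplexConjugation (Rat.castHom ℝ) c)
    (Kp : IntermediateField ℚ ↥(W.divisionField 3)) (hKp : Kp = fixedField (Subgroup.zpowers (absRestrictNormalHom (W.divisionField 3) c)))
    (hh : haveI : NumberField ↥(W.divisionField 3) := NumberField.mk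
      ¬ 3 ∣ NumberField.classNumber ↥Kp) {s : ℕ}
    (hs : {v : HeightOneSpectrum (𝓞 ↥Kp) | ((3 : ℕ) : 𝓞 ↥Kp) ∈ v.asIdeal}.ncard = s)
    (hram : ∀ κE : ZpExtension ↥Kp 3, κE.IsCyclotomic → TotallyRamifiedFrom κE 0)
    (hidx : haveI : NumberField ↥(W.divisionField 3) := NumberField.mk
      ∀ κE : ZpExtension ↥Kp 3, κE.IsCyclotomic →
      haveI : FiniteDimensional ↥Kp (κE.layer 1) := κE.finiteDimensional_layer_holds 1
      (unitsE (κE.layer 1) ⊓ (⊤ : Subgroup (κE.layer 1)ˣ).map (Herbrand.norm (κE.layer 1 ≃ₐ[↥Kp] κE.layer 1))).relIndex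
        (unitsE (κE.layer 1) ⊓ (unitsIncl ↥Kp (κE.layer 1)).range) * 3 = 3 ^ s) :
    MissingUpperBoundAt W 3 :=
  WildFineSelmerSupersingularCMAnchor.missingUpperBoundAt_wild_of_conjA hKatoA hGZK hmod W hr hO hirr
    (conjA_three_of_hasSplitCartanNormalizerModPImage_of_realUnitIndex W hCS hFW hF1 himg hc Kp hKp hh hs hram hidx)

set_option synthInstance.maxHeartbeats 400000 in
set_option maxHeartbeats 4000000 in
/-- **U₀ at a `3Ns` residue row from FUKUDA (0,1) on `K⁺`** (named facts {A161-fine, GZK, modularity, `hCS`, `hFW`, `hF1`} + displayed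
`hram`, `hord` about `Kp = ℚ(W[3])^c`). CONDITIONAL; nothing booked; BSD for no curve. [cite: Kato2004Asterisque, Thm. 14.5 (3) (p. 236)]
[cite: Fukuda1994, Thm. 1 (1), p. 264] [cite: CoatesSujatha2005, Thm. 3.4 (§3)] -/
theorem missingUpperBoundAt_three_of_hasSplitCartanNormalizerModPImage_of_realSuccEq
    (hKatoA : Kato2004.rankZero_padicValNat_sha_add_padicValNat_tamagawa_le_of_additive_potGood_of_irreducible_of_fineSelmerDual_fg)
    (hGZK : rank_eq_analyticRank_of_analyticRank_le_one) (hmod : hasEntireLFunction_rat)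
    (hCS : CoatesSujatha2005.thm34_fineSelmerDual_moduleFinite_of_classicalMuVanishes_divisionField)
    (hFW : ferreroWashington1979_classicalMuVanishes) (hF1 : fukuda1994_thm1_classNumberPExp_const_of_succ_eq) [Fact (3 : ℕ).Prime]
    (hr : W.analyticRank = 0) (hO : ClassO6 W 3) (hirr : W.HasIrreducibleModPGaloisRep 3)
    (himg : HasSplitCartanNormalizerModPImage W 3) {c : absoluteGaloisGroup ℚ} (hc : IsComplexConjugation (Rat.castHom ℝ) c)
    (Kp : IntermediateField ℚ ↥(W.divisionField 3)) (hKp : Kp = fixedField (Subgroup.zpowers (absRestrictNormalHom (W.divisionField 3) c)))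
    (hram : ∀ κE : ZpExtension ↥Kp 3, κE.IsCyclotomic → TotallyRamifiedFrom κE 0)
    (hord : ∀ κE : ZpExtension ↥Kp 3, κE.IsCyclotomic → classNumberPExp κE (0 + 1) = classNumberPExp κE 0) :
    MissingUpperBoundAt W 3 :=
  WildFineSelmerSupersingularCMAnchor.missingUpperBoundAt_wild_of_conjA hKatoA hGZK hmod W hr hO hirr
    (conjA_three_of_hasSplitCartanNormalizerModPImage_of_realSuccEq W hCS hFW hF1 himg hc Kp hKp hram hord)

set_option synthInstance.maxHeartbeats 400000 in
set_option maxHeartbeats 4000000 in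
/-- **U₀ at a `3Nn` residue row from the UNIT NORM-INDEX criterion on `K⁺`** (+ Iwasawa's growth theorem `hI`). CONDITIONAL; nothing
booked; BSD for no curve. [cite: Kato2004Asterisque, Thm. 14.5 (3) (p. 236)] [cite: Lang1990, Ch. 13 §4, Lemma 4.1 (PDF p. 203)]
[cite: CoatesSujatha2005, Thm. 3.4 (§3)] -/
theorem missingUpperBoundAt_three_of_hasModPImageEqNonsplitCartanNormalizer_of_realUnitIndex
    (hKatoA : Kato2004.rankZero_padicValNat_sha_add_padicValNat_tamagawa_le_of_additive_potGood_of_irreducible_of_fineSelmerDual_fg)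
    (hGZK : rank_eq_analyticRank_of_analyticRank_le_one) (hmod : hasEntireLFunction_rat)
    (hCS : CoatesSujatha2005.thm34_fineSelmerDual_moduleFinite_of_classicalMuVanishes_divisionField)
    (hI : iwasawa1959_classNumberPExp_growth) (hFW : ferreroWashington1979_classicalMuVanishes)
    (hF1 : fukuda1994_thm1_classNumberPExp_const_of_succ_eq) [Fact (3 : ℕ).Prime]
    (hr : W.analyticRank = 0) (hO : ClassO6 W 3) (hirr : W.HasIrreducibleModPGaloisRep 3)
    (himg : HasModPImageEqNonsplitCartanNormalizer W 3) {c : absoluteGaloisGroup ℚ} (hc : IsComplexConjugation (Rat.castHom ℝ) c)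
    (Kp : IntermediateField ℚ ↥(W.divisionField 3)) (hKp : Kp = fixedField (Subgroup.zpowers (absRestrictNormalHom (W.divisionField 3) c)))
    (hh : haveI : NumberField ↥(W.divisionField 3) := NumberField.mk
      ¬ 3 ∣ NumberField.classNumber ↥Kp) {s : ℕ}
    (hs : {v : HeightOneSpectrum (𝓞 ↥Kp) | ((3 : ℕ) : 𝓞 ↥Kp) ∈ v.asIdeal}.ncard = s)
    (hram : ∀ κE : ZpExtension ↥Kp 3, κE.IsCyclotomic → TotallyRamifiedFrom κE 0)
    (hidx : haveI : NumberField ↥(W.divisionField 3) := NumberField.mk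
      ∀ κE : ZpExtension ↥Kp 3, κE.IsCyclotomic →
      haveI : FiniteDimensional ↥Kp (κE.layer 1) := κE.finiteDimensional_layer_holds 1
      (unitsE (κE.layer 1) ⊓ (⊤ : Subgroup (κE.layer 1)ˣ).map (Herbrand.norm (κE.layer 1 ≃ₐ[↥Kp] κE.layer 1))).relIndex
        (unitsE (κE.layer 1) ⊓ (unitsIncl ↥Kp (κE.layer 1)).range) * 3 = 3 ^ s) :
    MissingUpperBoundAt W 3 :=
  WildFineSelmerSupersingularCMAnchor.missingUpperBoundAt_wild_of_conjA hKatoA hGZK hmod W hr hO hirr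
    (conjA_three_of_hasModPImageEqNonsplitCartanNormalizer_of_realUnitIndex W hCS hI hFW hF1 himg hc Kp hKp hh hs hram hidx)

end Cartan

/-! ## §3 U₀ at `p = 3` on `L_P = ℚ(W[3])^{U_P}` (the `GL₂(𝔽₃)`-image residue rows): unit norm-index / Fukuda (0,1) -/

section Unipotent

variable (W : WeierstrassCurve ℚ) [W.IsElliptic] [W.IsGloballyMinimal]

/-- **U₀ at a residue row from the UNIT NORM-INDEX criterion on `L_P = ℚ(W[3])^{U_P}`** (`= ℚ(P, ζ₃)` for `P ≠ 0`; degree `16` on a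
`GL₂(𝔽₃)`-image row): `MissingUpperBoundAt W 3` for a rank-`0` O6 row with `W[3]` irreducible, from the named facts {A161-fine `hKatoA`,
GZK, modularity, Lim 2017 Thm. 3.5 `hLim`, Fukuda Thm. 1 (1) `hF1`} and the displayed numerics on `L_P`: `3 ∤ h(L_P)`, `s` primes above
`3`, Fukuda index `0`, first-layer unit norm index `3^{s−1}`. No image hypothesis. CONDITIONAL; nothing booked; BSD for no curve.
[cite: Kato2004Asterisque, Thm. 14.5 (3) (p. 236)] [cite: Lim2017FineSelmer, §3 Thm. 3.5 and Lemma 3.2 (arXiv:1306.2047 pp. 6–7)]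
[cite: Lang1990, Ch. 13 §4, Lemma 4.1 (PDF p. 203)] [cite: Fukuda1994, Thm. 1 (1), p. 264] -/
theorem missingUpperBoundAt_three_of_relIndex_mul_eq_unipotentStabilizerField
    (hKatoA : Kato2004.rankZero_padicValNat_sha_add_padicValNat_tamagawa_le_of_additive_potGood_of_irreducible_of_fineSelmerDual_fg)
    (hGZK : rank_eq_analyticRank_of_analyticRank_le_one) (hmod : hasEntireLFunction_rat)
    (hLim : Lim2017.thm35_fineSelmerDual_moduleFinite_of_classicalMuVanishes_of_le_divisionField)
    (hF1 : fukuda1994_thm1_classNumberPExp_const_of_succ_eq) [Fact (3 : ℕ).Prime]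
    (hr : W.analyticRank = 0) (hO : ClassO6 W 3) (hirr : W.HasIrreducibleModPGaloisRep 3) (P : W.geomTorsion (3 : ℕ))
    (hh : haveI := numberField_unipotentStabilizerField W 3 P
      ¬ 3 ∣ NumberField.classNumber ↥(W.unipotentStabilizerField 3 P)) {s : ℕ}
    (hs : {v : HeightOneSpectrum (𝓞 ↥(W.unipotentStabilizerField 3 P)) |
        ((3 : ℕ) : 𝓞 ↥(W.unipotentStabilizerField 3 P)) ∈ v.asIdeal}.ncard = s)
    (hram : ∀ κ : ZpExtension ↥(W.unipotentStabilizerField 3 P) 3, κ.IsCyclotomic → TotallyRamifiedFrom κ 0)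
    (hidx : haveI := numberField_unipotentStabilizerField W 3 P
      ∀ κ : ZpExtension ↥(W.unipotentStabilizerField 3 P) 3, κ.IsCyclotomic →
      haveI : FiniteDimensional ↥(W.unipotentStabilizerField 3 P) (κ.layer 1) := κ.finiteDimensional_layer_holds 1
      (unitsE (κ.layer 1) ⊓ (⊤ : Subgroup (κ.layer 1)ˣ).map
          (Herbrand.norm (κ.layer 1 ≃ₐ[↥(W.unipotentStabilizerField 3 P)] κ.layer 1))).relIndex
        (unitsE (κ.layer 1) ⊓ (unitsIncl ↥(W.unipotentStabilizerField 3 P) (κ.layer 1)).range) * 3 = 3 ^ s) :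
    MissingUpperBoundAt W 3 :=
  WildFineSelmerSupersingularCMAnchor.missingUpperBoundAt_wild_of_conjA hKatoA hGZK hmod W hr hO hirr
    (fineSelmerDual_moduleFinite_of_relIndex_mul_eq_unipotentStabilizerField hF1 hLim W 3 (by decide) P hh hs hram hidx)

/-- **U₀ at a residue row from FUKUDA (0,1) on `L_P = ℚ(W[3])^{U_P}`** (conjA-anchor g9's door
`Lim2017.fineSelmerDual_moduleFinite_of_classNumberPExp_succ_eq_unipotentStabilizerField` at `n = 0`, then k9-c4 g5's
`missingUpperBoundAt_wild_of_conjA`): named facts {A161-fine, GZK, modularity, `hLim`, `hF1`} + displayed `hram` (Fukuda index `0`) and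
`hord` (`ord₃ h(L_{P,1}) = ord₃ h(L_P)`) on `L_P`. The door conjA-anchor g9's census used for 14/20 `GL₂(𝔽₃)`-image K9 rows (j296187).
CONDITIONAL; nothing booked; BSD for no curve. [cite: Kato2004Asterisque, Thm. 14.5 (3) (p. 236)]
[cite: Lim2017FineSelmer, §3 Thm. 3.5 and Lemma 3.2 (arXiv:1306.2047 pp. 6–7)] [cite: Fukuda1994, Thm. 1 (1), p. 264] -/
theorem missingUpperBoundAt_three_of_classNumberPExp_succ_eq_unipotentStabilizerField
    (hKatoA : Kato2004.rankZero_padicValNat_sha_add_padicValNat_tamagawa_le_of_additive_potGood_of_irreducible_of_fineSelmerDual_fg)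
    (hGZK : rank_eq_analyticRank_of_analyticRank_le_one) (hmod : hasEntireLFunction_rat)
    (hLim : Lim2017.thm35_fineSelmerDual_moduleFinite_of_classicalMuVanishes_of_le_divisionField)
    (hF1 : fukuda1994_thm1_classNumberPExp_const_of_succ_eq) [Fact (3 : ℕ).Prime]
    (hr : W.analyticRank = 0) (hO : ClassO6 W 3) (hirr : W.HasIrreducibleModPGaloisRep 3) (P : W.geomTorsion (3 : ℕ))
    (hram : ∀ κ : ZpExtension ↥(W.unipotentStabilizerField 3 P) 3, κ.IsCyclotomic → TotallyRamifiedFrom κ 0)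
    (hord : ∀ κ : ZpExtension ↥(W.unipotentStabilizerField 3 P) 3, κ.IsCyclotomic →
      classNumberPExp κ (0 + 1) = classNumberPExp κ 0) :
    MissingUpperBoundAt W 3 :=
  WildFineSelmerSupersingularCMAnchor.missingUpperBoundAt_wild_of_conjA hKatoA hGZK hmod W hr hO hirr
    (Lim2017.fineSelmerDual_moduleFinite_of_classNumberPExp_succ_eq_unipotentStabilizerField hF1 hLim W 3 (by decide) 0 P hram hord)

end Unipotent

end Summit.BirchSwinnertonDyer.BirchSwinnertonDyer.Theorems.UnitIndexMuDoors

end
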